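import Mathlib
import HarnessLib
import Literature.MathematicalPhysics.QuantumLattice.KohnLuttinger
import Literature.MathematicalPhysics.QuantumLattice.KohnLuttingerChannelStates
import Literature.MathematicalPhysics.QuantumLattice.KohnLuttingerPairingFormPolar
import Literature.MathematicalPhysics.QuantumLattice.KohnLuttingerLindhardMeasurable
import Summits.HubbardSuperconductivity.HubbardSuperconductivity.Theorems.WeakCouplingBCSWcbcsKohnLuttingerB1gReduction
import Summits.HubbardSuperconductivity.HubbardSuperconductivity.Theorems.WeakCouplingBCSWcbcsKohnLuttingerB1gKlCertForm
import Summits.HubbardSuperconductivity.HubbardSuperconductivity.Theorems.WeakCouplingBCSKlCertTPrimePHReflection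
import Summits.HubbardSuperconductivity.HubbardSuperconductivity.Theorems.ChiralWindowCwChannelInfContinuousL2
import Summits.HubbardSuperconductivity.HubbardSuperconductivity.Theorems.ChiralWindowCwKLChiralWindowD4Invariant
import Summits.HubbardSuperconductivity.HubbardSuperconductivity.Theorems.ChiralWindowCwThesisChannelInfNonpos
import Summits.HubbardSuperconductivity.HubbardSuperconductivity.Theorems.WeakCouplingBCSWcbcsKohnLuttingerB1gSublatticeDuality
import Summits.HubbardSuperconductivity.HubbardSuperconductivity.Theorems.WeakCouplingBCSKlSublatticeHolds
import Summits.HubbardSuperconductivity.HubbardSuperconductivity.Theorems.WeakCouplingBCSKlSublatticeFlip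
import Summits.HubbardSuperconductivity.HubbardSuperconductivity.Theorems.WeakCouplingBCSKlSublatticeEvenOdd

/-!
# The band `squareDispersion 0 (-1)` at `μ ∈ (-4, 0)`: finiteness, deck symmetry, Hilbert–Schmidt («(KLSCAN)-SUBLATTICE-DUALITY-DISCHARGE»
# part 12, toward S3; cell gate-hubbard-kl, seat p4 g20)

Everything by transport along the `(π, 0)`-flip `T₁` of part 10 (`T₁_* σ[-ε'] = σ[ε']`, same kernel):

* `klsl_isFiniteMeasure_neg`, `klsl_measurePreserving_shift_neg` (`D_* σ[-ε'] = σ[-ε']`, conjugating the deck symmetry of `σ'` by `T₁`,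
  which commutes with `D`), `klsl_kernel_neg_shift_right`, `klsl_ae_mem_klphGood_neg`, `klsl_ae_prod_mem_brillouinZone`,
  `klsl_lindhardFunction_nnn_flip`, **`klsl_kernelHS_neg`**, and the generic **`klsl_bddBelow_of`** (finite measure + Hilbert–Schmidt
  ⇒ value sets bounded below).

Honest framing: exact symmetry bookkeeping for a free band; nothing asserts a margin, the window, `K₃` or superconductivity.
-/

noncomputable section

set_option linter.dupNamespace false

namespace Summit.HubbardSuperconductivity.HubbardSuperconductivity.Theorems

open MeasureTheory Real Set Literature.MathematicalPhysics.QuantumLattice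
open scoped ENNReal Pointwise

/-! ### §25 The band `squareDispersion 0 (-1)`: deck symmetry, finiteness, Hilbert–Schmidt, deck-odd states -/

/-- The Fermi-curve measure of `squareDispersion 0 (-1)` is finite on `(-4, 0)` (its mass is that of `σ'`, by the flip). [folklore] -/
theorem klsl_isFiniteMeasure_neg {μ : ℝ} (hμ : μ ∈ Ioo (-4 : ℝ) 0) :
    IsFiniteMeasure (fermiCurveMeasure (squareDispersion 0 (-1)) μ) := by
  haveI := klsl_isFiniteMeasure_nnn hμ
  refine ⟨?_⟩
  rw [← preimage_univ (f := klslFlip), (klsl_measurePreserving_flip_fermi μ).measure_preimage MeasurableSet.univ.nullMeasurableSet]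
  exact measure_lt_top _ _

/-- The flip commutes with the deck shift. [folklore] -/
theorem klslFlip_klphShift (k : Momentum) : klslFlip (klphShift k) = klphShift (klslFlip k) := by
  ext i; fin_cases i <;> simp [klphTau_klphTau]

/-- **`D_* σ[-ε', μ] = σ[-ε', μ]`** (conjugate the deck symmetry of `σ'` by the flip). [folklore] -/
theorem klsl_measurePreserving_shift_neg (μ : ℝ) :
    MeasurePreserving klphShift (fermiCurveMeasure (squareDispersion 0 (-1)) μ) (fermiCurveMeasure (squareDispersion 0 (-1)) μ) := by
  refine ⟨klph_measurable_shift, ?_⟩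
  have hT' := (klsl_measurePreserving_flip_fermi' μ).map_eq
  have hD := (klsl_measurePreserving_shift_nnn μ).map_eq
  conv_lhs => rw [← hT', Measure.map_map klph_measurable_shift klsl_measurable_flip]
  have hcomm : klphShift ∘ klslFlip = klslFlip ∘ klphShift := funext fun k => (klslFlip_klphShift k).symm
  rw [hcomm, ← Measure.map_map klsl_measurable_flip klph_measurable_shift, hD, hT']

/-- The kernel of `squareDispersion 0 (-1)` is deck-blind in the second slot on the zone. [folklore] -/
theorem klsl_kernel_neg_shift_right (μ U : ℝ) (k : Momentum) {k' : Momentum} (hk' : k' ∈ brillouinZone) :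
    kohnLuttingerKernel (squareDispersion 0 (-1)) μ U k (klphShift k') = kohnLuttingerKernel (squareDispersion 0 (-1)) μ U k k' := by
  rw [klsl_kohnLuttingerKernel_negSign, klsl_kernel_nnn_shift_right μ U k hk']

/-- The good set is `σ[-ε', μ]`-full (pull back along the flip, which preserves the good set). [folklore] -/
theorem klsl_ae_mem_klphGood_neg (μ : ℝ) : ∀ᵐ k ∂fermiCurveMeasure (squareDispersion 0 (-1)) μ, k ∈ klphGood := by
  have hT := klsl_measurePreserving_flip_fermi μ
  have h : ∀ᵐ k ∂Measure.map klslFlip (fermiCurveMeasure (squareDispersion 0 (-1)) μ), k ∈ klphGood := by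
    rw [hT.map_eq]; exact klsl_ae_mem_klphGood_nnn μ
  filter_upwards [ae_of_ae_map klsl_measurable_flip.aemeasurable h] with k hk
  have := klsl_klslFlip_mem_klphGood hk
  rwa [klslFlip_klslFlip] at this

/-- Both factors of a `σ ⊗ σ`-typical pair lie in the zone. [folklore] -/
theorem klsl_ae_prod_mem_brillouinZone {ε : Momentum → ℝ} (hε : Measurable ε) (μ : ℝ) [SFinite (fermiCurveMeasure ε μ)] :
    ∀ᵐ z ∂(fermiCurveMeasure ε μ).prod (fermiCurveMeasure ε μ), z.1 ∈ brillouinZone ∧ z.2 ∈ brillouinZone := by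
  have hF0 : fermiCurveMeasure ε μ (fermiCurve ε μ)ᶜ = 0 :=
    measure_eq_zero_iff_ae_notMem.2 ((ae_mem_fermiCurve hε μ).mono fun k hk h => h hk)
  have hnull : (fermiCurveMeasure ε μ).prod (fermiCurveMeasure ε μ)
      (((fermiCurve ε μ)ᶜ ×ˢ (univ : Set Momentum)) ∪ ((univ : Set Momentum) ×ˢ (fermiCurve ε μ)ᶜ)) = 0 := by
    refine measure_union_null ?_ ?_
    · rw [Measure.prod_prod, hF0, zero_mul]
    · rw [Measure.prod_prod, hF0, mul_zero]
  filter_upwards [measure_eq_zero_iff_ae_notMem.1 hnull] with z hz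
  simp only [mem_union, mem_prod, mem_compl_iff, mem_univ, and_true, true_and, not_or, not_not] at hz
  exact ⟨hz.1.1, hz.2.1⟩

/-- `χ₀'(T₁ k + T₁ k') = χ₀'(k + k')` on the zone. [folklore] -/
theorem klsl_lindhardFunction_nnn_flip (μ : ℝ) {k k' : Momentum} (hk : k ∈ brillouinZone) (hk' : k' ∈ brillouinZone) :
    lindhardFunction (squareDispersion 0 1) μ (klslFlip k + klslFlip k') = lindhardFunction (squareDispersion 0 1) μ (k + k') := by
  have h := klsl_kernel_nnn_flip (μ := μ) 1 hk hk'
  simp only [kohnLuttingerKernel, one_pow, one_mul, add_right_inj] at h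
  exact h

/-- **The Lindhard kernel of `squareDispersion 0 (-1)` is Hilbert–Schmidt on its Fermi-curve measure** for `μ ∈ (-4, 0)` (transport of
`klsl_kernelHS_nnn` along `T₁ × T₁`). [folklore] -/
theorem klsl_kernelHS_neg {μ : ℝ} (hμ : μ ∈ Ioo (-4 : ℝ) 0) :
    MemLp (fun z : Momentum × Momentum => lindhardFunction (squareDispersion 0 (-1)) μ (z.1 + z.2)) 2
      ((fermiCurveMeasure (squareDispersion 0 (-1)) μ).prod (fermiCurveMeasure (squareDispersion 0 (-1)) μ)) := by
  haveI := klsl_isFiniteMeasure_nnn hμ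
  haveI := klsl_isFiniteMeasure_neg hμ
  have hK := klsl_kernelHS_nnn hμ
  have hmp := (klsl_measurePreserving_flip_fermi μ).prod (klsl_measurePreserving_flip_fermi μ)
  have h := hK.comp_measurePreserving hmp
  refine h.ae_eq ?_
  filter_upwards [klsl_ae_prod_mem_brillouinZone (measurable_squareDispersion 0 (-1)) μ] with z hz
  simp only [Function.comp_apply, Prod.map_fst, Prod.map_snd, klsl_lindhardFunction_negSign,
    klsl_lindhardFunction_nnn_flip μ hz.1 hz.2]

/-- **Bounded below** (hypothesis form: finite Fermi-curve measure + Hilbert–Schmidt kernel). [cite: RaghuKivelsonScalapino2010, §II (13)] -/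
theorem klsl_bddBelow_of {ε : Momentum → ℝ} {μ : ℝ} [IsFiniteMeasure (fermiCurveMeasure ε μ)]
    (hK : MemLp (fun z : Momentum × Momentum => lindhardFunction ε μ (z.1 + z.2)) 2
      ((fermiCurveMeasure ε μ).prod (fermiCurveMeasure ε μ))) (U : ℝ) (χ : D4Irrep) :
    BddBelow ((pairingForm ε μ U) '' {ψ | IsChannelState ε μ χ ψ}) := by
  refine ⟨-(|U| * (fermiCurveMeasure ε μ).real univ) -
    U ^ 2 * Real.sqrt (∫ z, (lindhardFunction ε μ (z.1 + z.2)) ^ 2 ∂(fermiCurveMeasure ε μ).prod (fermiCurveMeasure ε μ)), ?_⟩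
  rintro x ⟨ψ, hψ, rfl⟩
  have hsplit := klhs_frame_pairingForm_split U hK hψ.1
  have hQ := abs_integral_mul_integral_mul_le (M := fun z : Momentum × Momentum => lindhardFunction ε μ (z.1 + z.2)) hψ.1 hK
  rw [hψ.2.1, one_mul] at hQ
  have hone : MemLp (fun _ : Momentum => (1 : ℝ)) 2 (fermiCurveMeasure ε μ) := memLp_const 1
  have hcs := abs_integral_mul_le_sqrt_mul_sqrt hone hψ.1
  simp only [one_mul, one_pow, integral_const, smul_eq_mul, mul_one] at hcs
  rw [hψ.2.1, Real.sqrt_one, mul_one] at hcs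
  have hM0 : 0 ≤ (fermiCurveMeasure ε μ).real univ := measureReal_nonneg
  have hsq : (∫ k, ψ k ∂fermiCurveMeasure ε μ) ^ 2 ≤ (fermiCurveMeasure ε μ).real univ := by
    have h1 := pow_le_pow_left₀ (abs_nonneg _) hcs 2
    rwa [sq_abs, Real.sq_sqrt hM0] at h1
  rw [hsplit]
  have hQ' := neg_abs_le (∫ k, ψ k * ∫ k', lindhardFunction ε μ (k + k') * ψ k' ∂fermiCurveMeasure ε μ ∂fermiCurveMeasure ε μ)
  have hU : -(|U| * (fermiCurveMeasure ε μ).real univ) ≤ U * (∫ k, ψ k ∂fermiCurveMeasure ε μ) ^ 2 := by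
    have h2 : -|U| ≤ U := neg_abs_le U
    have h3 : U ≤ |U| := le_abs_self U
    nlinarith [sq_nonneg (∫ k, ψ k ∂fermiCurveMeasure ε μ), abs_nonneg U]
  nlinarith [sq_nonneg U]

end Summit.HubbardSuperconductivity.HubbardSuperconductivity.Theorems

end
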